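/-
Origin: expansion seat `prover-pub-hodgecm-mc-binder-2-g7-0`, handover #15 19:20Z md5 8fa8be3e02c1 (120 l.; imports #14 only — INSTALL AFTER #14, DROP-ONLY-THIS-ROW on bounce; V-SIDE dictionary: `linSubst_star_dualPairι_X_PR_general` / `_X_PS_general` (entries of `star (dualPairι k)` on the printed blocks for general k), **`linSubst_star_dualPairι_kV_rename_P`**: `linSubst (star (dualPairι ((a,b),(1,1)))) (rename ι P) = rename ι P` (the pairing polynomial `Σ_a z_a w_a` is `K_V`-invariant, `a a⋆ = 1`), `…_rename_P_pow`, **`unitaryOpPi_dualPairι_kV_binvPi_P_pow`**: `unitaryOpPi (dualPairι ((a,b),(1,1))) (binvPi (rename ι (P^k))) = binvPi (rename ι (P^k))` ⇒ with #9 the printed vectors of a Σ₁₂ place are `K_{V,b}`-ISOTYPIC with scalar character `vacScalar e_b` = `det(a)^{e_P(b)}` — the (V-val)/`nVOf` side of the census; mirror `lean -o` rc 0 / 0 warn; `#print axioms` trio (`g7/certs/KTypeDictionary_mirror.txt`)) (`HOME/mc/pub-hodgecm-mc-binder-2/g7/pkg/HodgeCM/Model/HypCensus/KTypeDictionary.lean`,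 md5 8fa8be3e, 120 lines);
landed by the gen-13 packager (p-g13) in gate run 37 as `HodgeCM/Model/HypCensus/KTypeDictionary.lean` (verbatim).
-/
/-
Origin: speedrun cell pub-hodgecm, MODEL-CONSTRUCTION sub-cell, lineage mc-binder-2 (rows A12/A34 of the binder ledger:
`hyp12` / `hyp34`), seat prover-pub-hodgecm-mc-binder-2-g7-0 (gen 7), 2026-08-19.  Target in PKG:
`HodgeCM/Model/HypCensus/KTypeDictionary.lean` (NEW additive leaf; imports this lineage's `TorusDictionary` only).  KERNEL only.
-/
import Summits.HodgeConjecture.HodgeCM.Model.HypCensus.TorusDictionary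

/-!
# Census kit (rows A12/A34), dictionary (`V`-side): the printed vectors of a `Σ₁₂` place are FIXED by Konno–Konno's `K_V`-letters

At a `Σ₁₂` place `b` the printed local model is `ℂ[P] ⊂ ℂ[z_a, w_a]`, `P = Σ_a z_a w_a` (pv12: `kappaPartM = span{P^k}`, the
`U(3)`-invariants, PerL v5 l. 502).  On the kernel side the compact group `K_{V,b} × K_{W,b}` acts on Fock vectors by
`κOp e_b k = vacScalar e_b k • unitaryOpPi (dualPairι k)` (`TorusBlock`, #9) and `unitaryOpPi U (binvPi F) = binvPi (linSubst (star U) F)`.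
This leaf proves that the `K_V`-letters `((a, b), (1, 1))` act TRIVIALLY on the printed polynomials (so on printed vectors `κOp` is the
scalar `vacScalar e_b`, i.e. the printed vectors are `K_{V,b}`-isotypic with character `det^{e_P(b)}` — the (V-val) side of the census):

* §1 the entries of `star (dualPairι ((a,b),(c,d)))` on the two printed blocks for GENERAL `k` (`_X_PR_general`, `_X_PS_general`);
* §2 **`linSubst_star_dualPairι_kV_rename_P`**: `linSubst (star (dualPairι ((a,b),(1,1)))) (rename ι P) = rename ι P` (`a a⋆ = 1`), hence
  **`linSubst_star_dualPairι_kV_rename_P_pow`** for every `P^k` and **`unitaryOpPi_dualPairι_kV_binvPi_P_pow`**: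
  `unitaryOpPi (dualPairι ((a,b),(1,1))) (binvPi (rename ι (P^k))) = binvPi (rename ι (P^k))`.

Nothing here is a claim of PerL/QW8.  Style lint (L-notation): no `local notation`.
-/

set_option autoImplicit false

noncomputable section

open MvPolynomial Complex
open scoped BigOperators ComplexConjugate Kronecker
open Literature.Analysis.SegalBargmann
open Literature.RepresentationTheory.KonnoKonno2007 Literature.RepresentationTheory.KonnoKonno2007.RealDualPair
open HodgeCM.PerL34.Fock HodgeCM.PerL34.Fock.PrintDict

namespace HodgeCM.Model.HypCensus

section KTypeDict

variable {P' R' S' : Type} [Fintype P'] [DecidableEq P'] [Fintype R'] [DecidableEq R'] [Fintype S'] [DecidableEq S']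
variable (Q' : Type) [Fintype Q'] [DecidableEq Q'] (eA : Fin 3 ≃ P') (r₀ : R') (s₀ : S')

/-! ## §1 Entries of `star (dualPairι k)` on the printed blocks, general `k` -/

/-- same-sign block: `X_{(p,r)} ↦ Σ_{p',r'} a_{p'p} c_{r'r} X_{(p',r')}`. [folklore] -/
theorem linSubst_star_dualPairι_X_PR_general (k : DPK P' Q' R' S') (p : P') (r : R') :
    linSubst (star ((dualPairι k : Matrix.unitaryGroup (DPIdx P' Q' R' S') ℂ) :
        Matrix (DPIdx P' Q' R' S') (DPIdx P' Q' R' S') ℂ)) (X (Sum.inl (Sum.inl (p, r)))) =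
      ∑ p' : P', ∑ r' : R', C ((k.1.1 : Matrix P' P' ℂ) p' p * (k.2.1 : Matrix R' R' ℂ) r' r) * X (Sum.inl (Sum.inl (p', r'))) := by
  rw [linSubst_X, coe_dualPairι]
  simp only [Fintype.sum_sum_type, Fintype.sum_prod_type, Matrix.star_apply, Matrix.fromBlocks_apply₁₁,
    Matrix.fromBlocks_apply₂₁, Matrix.map_apply, Matrix.kroneckerMap_apply, star_mul', star_star, Matrix.zero_apply,
    star_zero, map_zero, zero_mul, Finset.sum_const_zero, add_zero]

/-- mixed block: `X_{(p,s)} ↦ Σ_{p',s'} conj(a_{p'p}) conj(d_{s's}) X_{(p',s')}`. [folklore] -/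
theorem linSubst_star_dualPairι_X_PS_general (k : DPK P' Q' R' S') (p : P') (s : S') :
    linSubst (star ((dualPairι k : Matrix.unitaryGroup (DPIdx P' Q' R' S') ℂ) :
        Matrix (DPIdx P' Q' R' S') (DPIdx P' Q' R' S') ℂ)) (X (Sum.inr (Sum.inl (p, s)))) =
      ∑ p' : P', ∑ s' : S', C (star ((k.1.1 : Matrix P' P' ℂ) p' p) * star ((k.2.2 : Matrix S' S' ℂ) s' s)) *
        X (Sum.inr (Sum.inl (p', s'))) := by
  rw [linSubst_X, coe_dualPairι]
  simp only [Fintype.sum_sum_type, Fintype.sum_prod_type, Matrix.star_apply, Matrix.fromBlocks_apply₁₂,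
    Matrix.fromBlocks_apply₂₂, Matrix.fromBlocks_apply₁₁, Matrix.fromBlocks_apply₂₁, Matrix.kroneckerMap_apply, star_mul',
    Matrix.zero_apply, star_zero, map_zero, zero_mul, Finset.sum_const_zero, zero_add, add_zero]

/-! ## §2 The pairing polynomial is fixed by the `K_V`-letters -/

/-- **`Σ_p z_p w_p` is invariant under `K_V`**: `linSubst (star (dualPairι ((a,b),(1,1)))) (rename ι P) = rename ι P`. [folklore; the
unitarity `a a⋆ = 1`] -/
theorem linSubst_star_dualPairι_kV_rename_P (kV : Matrix.unitaryGroup P' ℂ × Matrix.unitaryGroup Q' ℂ) :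
    linSubst (star ((dualPairι ((kV, (1, 1)) : DPK P' Q' R' S') : Matrix.unitaryGroup (DPIdx P' Q' R' S') ℂ) :
        Matrix (DPIdx P' Q' R' S') (DPIdx P' Q' R' S') ℂ)) (rename (mixedToDPIdx Q' eA r₀ s₀) HodgeCM.PerL34.Fock.P) =
      rename (mixedToDPIdx Q' eA r₀ s₀) HodgeCM.PerL34.Fock.P := by
  -- unitarity of `a`: `Σ_p a_{p'p} conj(a_{p''p}) = δ_{p'p''}`
  have haa : ∀ p' p'' : P', ∑ p, ((kV.1 : Matrix.unitaryGroup P' ℂ) : Matrix P' P' ℂ) p' p *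
      star (((kV.1 : Matrix.unitaryGroup P' ℂ) : Matrix P' P' ℂ) p'' p) = if p' = p'' then 1 else 0 := by
    intro p' p''
    have h1 := Matrix.mem_unitaryGroup_iff.mp kV.1.2
    have h2 := congrFun (congrFun h1 p') p''
    simpa only [Matrix.mul_apply, Matrix.star_apply, Matrix.one_apply] using h2
  rw [rename_mixedToDPIdx_P, map_sum]
  simp only [map_mul, linSubst_star_dualPairι_X_PR_general, linSubst_star_dualPairι_X_PS_general, OneMemClass.coe_one,
    Matrix.one_apply, mul_ite, mul_one, mul_zero, apply_ite star, star_one, star_zero, apply_ite C, map_zero, ite_mul, zero_mul,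
    Finset.sum_ite_eq', Finset.mem_univ, if_true, Finset.sum_mul, Finset.mul_sum]
  -- now: Σ_p Σ_{p'} Σ_{p''} C a_{p'p} X_{p'} * (C conj(a_{p''p}) X_{p''}) = Σ_{p'} X_{p'} X'_{p'}
  rw [Finset.sum_comm]
  refine Finset.sum_congr rfl fun p' _ => ?_
  rw [Finset.sum_comm]
  have e : ∀ y : P', ∑ x : P', C (((kV.1 : Matrix.unitaryGroup P' ℂ) : Matrix P' P' ℂ) y x) *
        X (Sum.inl (Sum.inl (y, r₀)) : DPIdx P' Q' R' S') *
      (C (star (((kV.1 : Matrix.unitaryGroup P' ℂ) : Matrix P' P' ℂ) p' x)) * X (Sum.inr (Sum.inl (p', s₀)))) =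
      (X (Sum.inl (Sum.inl (y, r₀))) * X (Sum.inr (Sum.inl (p', s₀)))) *
        C (∑ x, ((kV.1 : Matrix.unitaryGroup P' ℂ) : Matrix P' P' ℂ) y x *
          star (((kV.1 : Matrix.unitaryGroup P' ℂ) : Matrix P' P' ℂ) p' x)) := fun y => by
    rw [map_sum, Finset.mul_sum]
    refine Finset.sum_congr rfl fun x _ => ?_
    rw [map_mul]
    ring
  simp only [e, haa, apply_ite C, map_one, map_zero, mul_ite, mul_one, mul_zero, Finset.sum_ite_eq', Finset.mem_univ, if_true]

/-- … hence every printed polynomial `P^k` is fixed. [folklore] -/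
theorem linSubst_star_dualPairι_kV_rename_P_pow (kV : Matrix.unitaryGroup P' ℂ × Matrix.unitaryGroup Q' ℂ) (k : ℕ) :
    linSubst (star ((dualPairι ((kV, (1, 1)) : DPK P' Q' R' S') : Matrix.unitaryGroup (DPIdx P' Q' R' S') ℂ) :
        Matrix (DPIdx P' Q' R' S') (DPIdx P' Q' R' S') ℂ)) (rename (mixedToDPIdx Q' eA r₀ s₀) (HodgeCM.PerL34.Fock.P ^ k)) =
      rename (mixedToDPIdx Q' eA r₀ s₀) (HodgeCM.PerL34.Fock.P ^ k) := by
  rw [map_pow, map_pow, linSubst_star_dualPairι_kV_rename_P]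

/-- **The `K_V`-letters fix the printed vectors**: `unitaryOpPi (dualPairι ((a,b),(1,1))) (binvPi (rename ι (P^k))) = binvPi (rename ι (P^k))`
— with `TorusBlock` (#9) the printed vectors are `K_{V,b}`-isotypic with the scalar character `vacScalar e_b ((a,b),(1,1)) = det(a)^{e_P} det(b)^{e_Q}`.
[Folland1989, Prop. (4.39)] -/
theorem unitaryOpPi_dualPairι_kV_binvPi_P_pow (kV : Matrix.unitaryGroup P' ℂ × Matrix.unitaryGroup Q' ℂ) (k : ℕ) :
    unitaryOpPi (dualPairι ((kV, (1, 1)) : DPK P' Q' R' S') : Matrix.unitaryGroup (DPIdx P' Q' R' S') ℂ)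
        (binvPi (rename (mixedToDPIdx Q' eA r₀ s₀) (HodgeCM.PerL34.Fock.P ^ k))) =
      binvPi (rename (mixedToDPIdx Q' eA r₀ s₀) (HodgeCM.PerL34.Fock.P ^ k)) := by
  rw [unitaryOpPi_binvPi, linSubst_star_dualPairι_kV_rename_P_pow]

end KTypeDict

end HodgeCM.Model.HypCensus

end
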